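import Mathlib
import Summits.Ventures.PercRepro2.Defs
import Summits.Ventures.PercRepro2.Harris
import Summits.Ventures.PercRepro2.Graph
import Summits.Ventures.PercRepro2.Events
import Summits.Ventures.PercRepro2.Induced
import Summits.Ventures.PercRepro2.CDAvoidAnti

/-!
# The event-revealment polarisation of BHK's inequality — the half-mass case
(blind cell PercRepro2, mine-a g38; MINE-A.md §93.7 (d), §93.9)

Root `s`, a finite set `X` of vertices, `R = {s ↮ X}` (`avoidAll`), and two up-set events of the
cluster of `s`, `U = {C_s ∈ 𝓤}`, `e = {C_s ∈ 𝓥}`.  The candidate (XOR) of MINE-A.md §93.7 (d) is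

  `P(R U e) P(Rᶜ) + P(Rᶜ U e) P(R) ≥ P(R U) P(Rᶜ e) + P(Rᶜ U) P(R e)`,

equivalently `Cov(U, e ∣ R) + Cov(U, e ∣ Rᶜ) + (P(U∣Rᶜ) − P(U∣R)) (P(e∣Rᶜ) − P(e∣R)) ≥ 0`: the
polarisation of Harris / BHK along the revealment of the event «does `C_s` meet `X`?» (the
analogue of the single-edge polarised BHK of §92.8, with the event in place of an edge).  BHK06
Thm 1.1 (`bhk_same_cluster_avoid`) gives `Cov(U, e ∣ R) ≥ 0`; the `Rᶜ`-world covariance has no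
sign.  THIS FILE: the case `P(R) ≤ 1/2` is a theorem — with `π = P(R)`, `a = P(RUe)`, `b = P(RU)`,
`d = P(Re)`, `c = P(Ue)`, `u = P(U)`, `ε = P(e)`,

  `π · XOR = (1 − 2π)(π a − b d) + π² (c − u ε) + (b − π u)(d − π ε)`

(`xorForm_identity`), and for `π ≤ 1/2` the three terms are ≥ 0 by BHK (`π a ≥ b d`), Harris
(`c ≥ u ε`) and the monotone conditioning (`b ≤ π u`, `d ≤ π ε`: a decreasing event against an
increasing one).  For `π > 1/2` the coefficient of `a` is negative and these inputs do not suffice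
(MINE-A.md §93.7 (d): an abstract witness); the full candidate stands on 2,105 exact random
instances and 1,360 weight-adversary instances with 0 negatives.  No definition beyond the
quantity is written out (no definition); one seat.
-/

namespace Summit.Ventures.PercRepro2

namespace XorHalf

variable {V : Type*} {E : Type*} [Fintype V] [DecidableEq V] [Fintype E] [DecidableEq E]
  {R : Type*} [Field R] [LinearOrder R] [IsStrictOrderedRing R]

omit [Fintype E] [DecidableEq E] [Fintype V] [DecidableEq V] in
/-- `{s ↮ X}` is a decreasing event. -/
lemma isLowerSet_avoidAll (ends : E → Sym2 V) (s : V) (X : Finset V) :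
    IsLowerSet (avoidAll ends s X) := by
  intro ω ω' h hω y hy hc
  exact hω y hy (conn_mono h hc)

omit [Fintype V] [DecidableEq V] in
/-- Complements through the additivity of `prob`: `P(Aᶜ ∩ B) = P(B) − P(A ∩ B)`. -/
lemma prob_compl_inter (p : E → R) (A B : Set (Config E)) :
    prob p (Aᶜ ∩ B) = prob p B - prob p (A ∩ B) := by
  have h := prob_inter_add_prob_inter_compl p B A
  rw [Set.inter_comm B A, Set.inter_comm B Aᶜ] at h
  linear_combination h

omit [Fintype V] [DecidableEq V] in
/-- `xorForm` in the seven masses: with `π = P(R)`, `a = P(RUe)`, `b = P(RU)`, `d = P(Re)`,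
`c = P(Ue)`, `u = P(U)`, `ε = P(e)`, `xorForm = a (1 − π) + (c − a) π − b (ε − d) − (u − b) d`. -/
theorem xorForm_eq (p : E → R) (ends : E → Sym2 V) (s : V) (X : Finset V) (𝓤 𝓥 : Set (Set V)) :
    let Rv := avoidAll ends s X
    let U := clusterInEvent ends s 𝓤
    let e := clusterInEvent ends s 𝓥
    prob p (Rv ∩ U ∩ e) * prob p Rvᶜ + prob p (Rvᶜ ∩ U ∩ e) * prob p Rv -
        prob p (Rv ∩ U) * prob p (Rvᶜ ∩ e) - prob p (Rvᶜ ∩ U) * prob p (Rv ∩ e) =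
      prob p (Rv ∩ U ∩ e) * (1 - prob p Rv) + (prob p (U ∩ e) - prob p (Rv ∩ U ∩ e)) * prob p Rv -
        prob p (Rv ∩ U) * (prob p e - prob p (Rv ∩ e)) -
        (prob p U - prob p (Rv ∩ U)) * prob p (Rv ∩ e) := by
  intro Rv U e
  have hc : prob p Rvᶜ = 1 - prob p Rv := prob_compl p Rv
  have hUe : prob p (Rvᶜ ∩ U ∩ e) = prob p (U ∩ e) - prob p (Rv ∩ U ∩ e) := by
    rw [Set.inter_assoc, prob_compl_inter, Set.inter_assoc]
  have hU : prob p (Rvᶜ ∩ U) = prob p U - prob p (Rv ∩ U) := prob_compl_inter p Rv U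
  have he : prob p (Rvᶜ ∩ e) = prob p e - prob p (Rv ∩ e) := prob_compl_inter p Rv e
  rw [hc, hUe, hU, he]

omit [Fintype V] [DecidableEq V] in
/-- **The identity**: `π · xorForm = (1 − 2π)(π a − b d) + π² (c − u ε) + (b − π u)(d − π ε)`. -/
theorem xorForm_identity (p : E → R) (ends : E → Sym2 V) (s : V) (X : Finset V)
    (𝓤 𝓥 : Set (Set V)) :
    let Rv := avoidAll ends s X
    let U := clusterInEvent ends s 𝓤
    let e := clusterInEvent ends s 𝓥
    prob p Rv * (prob p (Rv ∩ U ∩ e) * prob p Rvᶜ + prob p (Rvᶜ ∩ U ∩ e) * prob p Rv -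
        prob p (Rv ∩ U) * prob p (Rvᶜ ∩ e) - prob p (Rvᶜ ∩ U) * prob p (Rv ∩ e)) =
      (1 - 2 * prob p Rv) * (prob p Rv * prob p (Rv ∩ U ∩ e) - prob p (Rv ∩ U) * prob p (Rv ∩ e)) +
        prob p Rv ^ 2 * (prob p (U ∩ e) - prob p U * prob p e) +
        (prob p (Rv ∩ U) - prob p Rv * prob p U) * (prob p (Rv ∩ e) - prob p Rv * prob p e) := by
  intro Rv U e
  have h := xorForm_eq p ends s X 𝓤 𝓥
  simp only at h
  rw [h]
  ring

/-- **The half-mass theorem**: if `P(s ↮ X) ≤ 1/2` then `xorForm ≥ 0` — the polarisation of BHK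
along the revealment of `{s ↮ X}` holds whenever the avoiding world carries at most half the mass. -/
theorem xorForm_nonneg_of_half (p : E → R) (hp : IsProbVec p) (ends : E → Sym2 V) (s : V)
    (X : Finset V) {𝓤 𝓥 : Set (Set V)} (h𝓤 : IsUpperSet 𝓤) (h𝓥 : IsUpperSet 𝓥)
    (hhalf : 2 * prob p (avoidAll ends s X) ≤ 1) :
    let Rv := avoidAll ends s X
    let U := clusterInEvent ends s 𝓤
    let e := clusterInEvent ends s 𝓥
    0 ≤ prob p (Rv ∩ U ∩ e) * prob p Rvᶜ + prob p (Rvᶜ ∩ U ∩ e) * prob p Rv -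
        prob p (Rv ∩ U) * prob p (Rvᶜ ∩ e) - prob p (Rvᶜ ∩ U) * prob p (Rv ∩ e) := by
  intro Rv U e
  have hRv : Rv = avoidAll ends s X := rfl
  have hU : U = clusterInEvent ends s 𝓤 := rfl
  have he : e = clusterInEvent ends s 𝓥 := rfl
  have hRlow : IsLowerSet Rv := isLowerSet_avoidAll ends s X
  have hUup : IsUpperSet U := isUpperSet_clusterInEvent ends s h𝓤
  have heup : IsUpperSet e := isUpperSet_clusterInEvent ends s h𝓥
  -- BHK 1.1 with X = Y (same cluster, set avoidance)
  have hbhk : prob p (Rv ∩ U) * prob p (Rv ∩ e) ≤ prob p Rv * prob p (Rv ∩ U ∩ e) := by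
    have := CDAvoidAnti.bhk_same_cluster_avoid p ends hp s X h𝓤 h𝓥
    rw [← hRv, ← hU, ← he] at this
    have e1 : U ∩ Rv = Rv ∩ U := Set.inter_comm _ _
    have e2 : e ∩ Rv = Rv ∩ e := Set.inter_comm _ _
    have e3 : U ∩ e ∩ Rv = Rv ∩ U ∩ e := by ext ω; simp only [Set.mem_inter_iff]; tauto
    rw [e1, e2, e3] at this
    linarith
  -- Harris
  have hharris : prob p U * prob p e ≤ prob p (U ∩ e) := prob_mul_prob_le_prob_inter hp hUup heup
  -- monotone conditioning
  have hbU : prob p (Rv ∩ U) ≤ prob p Rv * prob p U :=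
    prob_inter_le_prob_mul_prob_of_isLowerSet hp hRlow hUup
  have hde : prob p (Rv ∩ e) ≤ prob p Rv * prob p e :=
    prob_inter_le_prob_mul_prob_of_isLowerSet hp hRlow heup
  have hπ0 : 0 ≤ prob p Rv := prob_nonneg hp Rv
  have hid := xorForm_identity p ends s X 𝓤 𝓥
  simp only at hid
  rw [← hRv, ← hU, ← he] at hid
  have h1 : 0 ≤ (1 - 2 * prob p Rv) * (prob p Rv * prob p (Rv ∩ U ∩ e) - prob p (Rv ∩ U) * prob p (Rv ∩ e)) :=
    mul_nonneg (by linarith) (by linarith)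
  have h2 : 0 ≤ prob p Rv ^ 2 * (prob p (U ∩ e) - prob p U * prob p e) :=
    mul_nonneg (sq_nonneg _) (by linarith)
  have h3 : 0 ≤ (prob p (Rv ∩ U) - prob p Rv * prob p U) * (prob p (Rv ∩ e) - prob p Rv * prob p e) := by
    have := mul_nonneg (neg_nonneg.mpr (by linarith : prob p (Rv ∩ U) - prob p Rv * prob p U ≤ 0))
      (neg_nonneg.mpr (by linarith : prob p (Rv ∩ e) - prob p Rv * prob p e ≤ 0))
    rwa [neg_mul_neg] at this
  have hprod : 0 ≤ prob p Rv * (prob p (Rv ∩ U ∩ e) * prob p Rvᶜ + prob p (Rvᶜ ∩ U ∩ e) * prob p Rv -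
      prob p (Rv ∩ U) * prob p (Rvᶜ ∩ e) - prob p (Rvᶜ ∩ U) * prob p (Rv ∩ e)) := by
    rw [hid]; linarith
  rcases hπ0.lt_or_eq with hpos | hzero
  · exact nonneg_of_mul_nonneg_right (by simpa [mul_comm] using hprod) hpos
  · -- the avoiding world is null: every `R`-mass vanishes and the form is zero
    have hb0 : prob p (Rv ∩ U) = 0 :=
      le_antisymm (by linarith [prob_inter_le_left hp Rv U]) (prob_nonneg hp _)
    have hd0 : prob p (Rv ∩ e) = 0 :=
      le_antisymm (by linarith [prob_inter_le_left hp Rv e]) (prob_nonneg hp _)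
    have ha0 : prob p (Rv ∩ U ∩ e) = 0 :=
      le_antisymm (by linarith [prob_inter_le_left hp (Rv ∩ U) e]) (prob_nonneg hp _)
    have h := xorForm_eq p ends s X 𝓤 𝓥
    simp only at h
    rw [← hRv, ← hU, ← he] at h
    rw [h, hb0, hd0, ha0, ← hzero]
    ring_nf
    exact le_refl 0

end XorHalf

end Summit.Ventures.PercRepro2
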